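import Mathlib

/-!
# Fluid computer blueprint — the SPEC ARITHMETIC of a dyadic cascade of gadgets

HONEST FRAMING: low prior, high value-of-information experiment on Tao's machine paradigm; NOT a
claim that NS blows up.

This file is the *closed-form bookkeeping* behind the spec sheet of the fluid-computer blueprint
(build `fluidc`): a dyadic cascade of "pump gadgets" carrying energy from frequency `λ_n = λ₀ 2ⁿ`
to `λ_{n+1}` within a transfer-time allowance `T_n ≤ C λ_n^{-α}`, keeping at least the fraction
`η` of the previous level's energy (`E_n ≥ E₀ ηⁿ`). Everything here is real analysis on geometric
sequences; no PDE enters. The numbers are the ones the assembly theorems of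
`Literature/Analysis/FluidPDE/FluidComputer/CascadeWitness.lean` and `…/GadgetCascade.lean` consume:

* `summable_Tmax` / `Tstar_eq` — the transfer times are summable iff `α > 0`, with total
  `T_* = C λ₀^{-α} / (1 - 2^{-α})` (the blow-up time bound);
* `viscousNumber` — the per-level viscous damping exponent `ν λ_n² T_n = ν C λ₀^{2-α} (2^{2-α})ⁿ`:
  bounded iff `α ≥ 2`, `→ 0` iff `α > 2`, `→ ∞` iff `α < 2` (Tao 2016, §1.3: the transfer must be
  "abrupt" enough to outrun dissipation; for the true equations the critical exponent is `α = 2`);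
* `concentration` — the `Ḣ¹`-type lower bound `E_n λ_n² = E₀ λ₀² (4η)ⁿ`, which diverges iff
  `η > 1/4`;
* `alphaEff` — the Kolmogorov/dimensional closure: if the gadget's transfer time is the eddy
  turn-over time `c ℓ_n^{5/2} E_n^{-1/2}` (`ℓ_n = λ_n^{-1}`), then it has exactly the form
  `C' λ_n^{-α_eff}` with `α_eff = 5/2 + ½ log₂ η`; hence the DICTIONARY
  `α_eff ≥ 2 ⟺ η ≥ 1/2` (beats viscosity), `α_eff > 0 ⟺ η > 2^{-5}` (summable at all).

Cross-check with Tao 2016, Prop. 5.1 / Thm. 6.2: Tao's averaged machine transfers in time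
`∼ λ_n^{-5/2} e_n^{-1}` with amplitude loss `(1+ε₀)^{±1/100}` per level, i.e. `η` as close to `1`
as desired, deep inside the regime `η ≥ 1/2`.

## References

* T. Tao, *Finite time blowup for an averaged three-dimensional Navier–Stokes equation*,
  J. Amer. Math. Soc. 29 (2016), arXiv:1402.0290v3, §1.3, §5 (Prop. 5.1), §6. [Tao2016AveragedNS]
-/

noncomputable section

open Real Filter Topology
open scoped BigOperators

namespace Literature.Analysis.FluidPDE.FluidComputer

/-- **Spec numbers of a dyadic gadget cascade.** `lam0` = base frequency `λ₀`, `C`/`alpha` = the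
transfer-time law `T_n ≤ C λ_n^{-α}`, `E0`/`eta` = the energy ladder `E_n ≥ E₀ ηⁿ` (`η` = net
fraction of energy handed to the next level, `0 < η ≤ 1`). FREQUENCY CONVENTION: `λ_n = λ₀ 2ⁿ` is a
wavenumber magnitude (`‖ξ‖ ≥ λ_n` on level `n`). [folklore] -/
structure CascadeSpecs where
  /-- base frequency `λ₀ > 0` -/
  lam0 : ℝ
  /-- transfer-time constant -/
  C : ℝ
  /-- transfer-time exponent: `T_n ≤ C λ_n^{-α}` -/
  alpha : ℝ
  /-- initial energy scale -/
  E0 : ℝ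
  /-- net energy-transfer efficiency per level -/
  eta : ℝ
  lam0_pos : 0 < lam0
  C_pos : 0 < C
  E0_pos : 0 < E0
  eta_pos : 0 < eta
  eta_le_one : eta ≤ 1

namespace CascadeSpecs

variable (S : CascadeSpecs)

/-! ### Frequencies and transfer times -/

/-- The frequency of level `n`: `λ_n = λ₀ 2ⁿ`. [folklore] -/
def lam (n : ℕ) : ℝ := S.lam0 * 2 ^ n

/-- `λ_n > 0`. [folklore] -/
theorem lam_pos (n : ℕ) : 0 < S.lam n := mul_pos S.lam0_pos (pow_pos two_pos n)

/-- `λ_{n+1} = 2 λ_n` (dyadic). [folklore] -/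
theorem lam_succ (n : ℕ) : S.lam (n + 1) = 2 * S.lam n := by
  unfold lam; rw [pow_succ]; ring

/-- Powers of the dyadic frequencies are geometric: `λ_n^s = λ₀^s (2^s)ⁿ`. [folklore] -/
theorem lam_rpow (s : ℝ) (n : ℕ) : S.lam n ^ s = S.lam0 ^ s * ((2 : ℝ) ^ s) ^ n := by
  unfold lam
  rw [Real.mul_rpow S.lam0_pos.le (pow_nonneg zero_le_two n), Real.rpow_pow_comm zero_le_two s n]

/-- The transfer-time allowance of level `n`: `T_n = C λ_n^{-α}`. [folklore] -/
def Tmax (n : ℕ) : ℝ := S.C * S.lam n ^ (-S.alpha)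

/-- `T_n > 0`. [folklore] -/
theorem Tmax_pos (n : ℕ) : 0 < S.Tmax n := mul_pos S.C_pos (Real.rpow_pos_of_pos (S.lam_pos n) _)

/-- `T_n ≥ 0`. [folklore] -/
theorem Tmax_nonneg (n : ℕ) : 0 ≤ S.Tmax n := (S.Tmax_pos n).le

/-- `T_n = C λ₀^{-α} (2^{-α})ⁿ` — a geometric sequence of ratio `2^{-α}`. [folklore] -/
theorem Tmax_eq_geometric (n : ℕ) :
    S.Tmax n = S.C * S.lam0 ^ (-S.alpha) * ((2 : ℝ) ^ (-S.alpha)) ^ n := by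
  unfold Tmax; rw [S.lam_rpow, mul_assoc]

/-- `2^{-α} < 1` for `α > 0` (the geometric ratio of the transfer times). [folklore] -/
theorem two_rpow_neg_lt_one {α : ℝ} (hα : 0 < α) : (2 : ℝ) ^ (-α) < 1 :=
  Real.rpow_lt_one_of_one_lt_of_neg one_lt_two (neg_neg_of_pos hα)

/-- **The transfer times are summable when `α > 0`.** [folklore] -/
theorem summable_Tmax (hα : 0 < S.alpha) : Summable S.Tmax := by
  have h : Summable fun n : ℕ => S.C * S.lam0 ^ (-S.alpha) * ((2 : ℝ) ^ (-S.alpha)) ^ n :=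
    (summable_geometric_of_lt_one (Real.rpow_nonneg zero_le_two _) (two_rpow_neg_lt_one hα)).mul_left _
  exact h.congr fun n => (S.Tmax_eq_geometric n).symm

/-- **They are NOT summable when `α ≤ 0`** (the terms do not even tend to zero). [folklore] -/
theorem not_summable_Tmax (hα : S.alpha ≤ 0) : ¬ Summable S.Tmax := by
  intro h
  have h0 := h.tendsto_atTop_zero
  have hge : ∀ n, S.C * S.lam0 ^ (-S.alpha) ≤ S.Tmax n := fun n => by
    rw [S.Tmax_eq_geometric]
    have h1 : (1 : ℝ) ≤ ((2 : ℝ) ^ (-S.alpha)) ^ n :=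
      one_le_pow₀ (Real.one_le_rpow one_le_two (by linarith))
    have hc : 0 ≤ S.C * S.lam0 ^ (-S.alpha) :=
      mul_nonneg S.C_pos.le (Real.rpow_nonneg S.lam0_pos.le _)
    nlinarith
  have hpos : 0 < S.C * S.lam0 ^ (-S.alpha) := mul_pos S.C_pos (Real.rpow_pos_of_pos S.lam0_pos _)
  have hev := (h0.eventually (gt_mem_nhds hpos)).exists
  obtain ⟨n, hn⟩ := hev
  exact absurd (hge n) (not_le.2 hn)

/-- The total time budget `T_* = ∑ T_n`. [folklore] -/
def Tstar : ℝ := ∑' n, S.Tmax n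

/-- **Closed form of the blow-up time bound**: `T_* = C λ₀^{-α} / (1 - 2^{-α})` for `α > 0`. [folklore] -/
theorem Tstar_eq (hα : 0 < S.alpha) :
    S.Tstar = S.C * S.lam0 ^ (-S.alpha) / (1 - (2 : ℝ) ^ (-S.alpha)) := by
  unfold Tstar
  rw [tsum_congr S.Tmax_eq_geometric, tsum_mul_left,
    tsum_geometric_of_lt_one (Real.rpow_nonneg zero_le_two _) (two_rpow_neg_lt_one hα),
    div_eq_mul_inv]

/-- Partial sums of the transfer times stay below `T_*` (`α > 0`). [folklore] -/
theorem sum_Tmax_le_Tstar (hα : 0 < S.alpha) (n : ℕ) :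
    ∑ m ∈ Finset.range n, S.Tmax m ≤ S.Tstar :=
  (S.summable_Tmax hα).sum_le_tsum _ fun m _ => S.Tmax_nonneg m

/-- `T_* > 0` (`α > 0`). [folklore] -/
theorem Tstar_pos (hα : 0 < S.alpha) : 0 < S.Tstar := by
  have h := S.sum_Tmax_le_Tstar hα 1
  rw [Finset.sum_range_one] at h
  exact (S.Tmax_pos 0).trans_le h

/-! ### The viscous number per level -/

/-- The **viscous number** of level `n`: `ν λ_n² T_n`, the exponent of the heat-flow damping
`e^{-ν λ_n² T_n}` suffered by a mode of frequency `λ_n` during the transfer window (Tao 2016, §1.3: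
the energy transfer has to happen faster than the dissipation time `1/(ν λ_n²)`). [cite: Tao2016AveragedNS, §1.3] -/
def viscousNumber (ν : ℝ) (n : ℕ) : ℝ := ν * S.lam n ^ 2 * S.Tmax n

/-- `ν λ_n² T_n = ν C λ₀^{2-α} (2^{2-α})ⁿ`. [folklore] -/
theorem viscousNumber_eq (ν : ℝ) (n : ℕ) :
    S.viscousNumber ν n = ν * S.C * S.lam0 ^ (2 - S.alpha) * ((2 : ℝ) ^ (2 - S.alpha)) ^ n := by
  unfold viscousNumber Tmax
  have h : S.lam n ^ 2 * S.lam n ^ (-S.alpha) = S.lam n ^ (2 - S.alpha) := by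
    rw [← Real.rpow_two, ← Real.rpow_add (S.lam_pos n)]; ring_nf
  calc ν * S.lam n ^ 2 * (S.C * S.lam n ^ (-S.alpha))
      = ν * S.C * (S.lam n ^ 2 * S.lam n ^ (-S.alpha)) := by ring
    _ = ν * S.C * S.lam0 ^ (2 - S.alpha) * ((2 : ℝ) ^ (2 - S.alpha)) ^ n := by
        rw [h, S.lam_rpow]; ring

/-- **`α ≥ 2`: the viscous numbers are bounded** (by the level-`0` value). [folklore] -/
theorem viscousNumber_le (hα : 2 ≤ S.alpha) {ν : ℝ} (hν : 0 ≤ ν) (n : ℕ) :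
    S.viscousNumber ν n ≤ ν * S.C * S.lam0 ^ (2 - S.alpha) := by
  rw [S.viscousNumber_eq]
  have h1 : ((2 : ℝ) ^ (2 - S.alpha)) ^ n ≤ 1 :=
    pow_le_one₀ (Real.rpow_nonneg zero_le_two _)
      (Real.rpow_le_one_of_one_le_of_nonpos one_le_two (by linarith))
  have hc : 0 ≤ ν * S.C * S.lam0 ^ (2 - S.alpha) :=
    mul_nonneg (mul_nonneg hν S.C_pos.le) (Real.rpow_nonneg S.lam0_pos.le _)
  exact (mul_le_of_le_one_right hc h1)

/-- **`α > 2`: the viscous numbers tend to zero** (viscosity is asymptotically invisible). [folklore] -/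
theorem tendsto_viscousNumber_zero (hα : 2 < S.alpha) (ν : ℝ) :
    Tendsto (S.viscousNumber ν) atTop (𝓝 0) := by
  have h : Tendsto (fun n : ℕ => ν * S.C * S.lam0 ^ (2 - S.alpha) * ((2 : ℝ) ^ (2 - S.alpha)) ^ n)
      atTop (𝓝 (ν * S.C * S.lam0 ^ (2 - S.alpha) * 0)) :=
    (tendsto_pow_atTop_nhds_zero_of_lt_one (Real.rpow_nonneg zero_le_two _)
      (Real.rpow_lt_one_of_one_lt_of_neg one_lt_two (by linarith))).const_mul _
  rw [mul_zero] at h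
  exact h.congr fun n => (S.viscousNumber_eq ν n).symm

/-- **`α < 2`: the viscous numbers diverge** — viscosity kills the cascade (for `ν > 0`). [folklore] -/
theorem tendsto_viscousNumber_atTop (hα : S.alpha < 2) {ν : ℝ} (hν : 0 < ν) :
    Tendsto (S.viscousNumber ν) atTop atTop := by
  have hc : 0 < ν * S.C * S.lam0 ^ (2 - S.alpha) :=
    mul_pos (mul_pos hν S.C_pos) (Real.rpow_pos_of_pos S.lam0_pos _)
  have h : Tendsto (fun n : ℕ => ν * S.C * S.lam0 ^ (2 - S.alpha) * ((2 : ℝ) ^ (2 - S.alpha)) ^ n)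
      atTop atTop :=
    (tendsto_pow_atTop_atTop_of_one_lt (Real.one_lt_rpow one_lt_two (by linarith))).const_mul_atTop hc
  exact h.congr fun n => (S.viscousNumber_eq ν n).symm

/-! ### The energy ladder and the concentration lower bound -/

/-- The energy floor of level `n`: `E_n = E₀ ηⁿ`. [folklore] -/
def Emin (n : ℕ) : ℝ := S.E0 * S.eta ^ n

/-- `E_n > 0`. [folklore] -/
theorem Emin_pos (n : ℕ) : 0 < S.Emin n := mul_pos S.E0_pos (pow_pos S.eta_pos n)

/-- The **concentration number** of level `n`: `E_n λ_n²`, a lower bound for `‖u‖²_{Ḣ¹}` (indeed for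
`∫_{‖ξ‖ ≥ λ_n} ‖ξ‖² ‖û‖²`) while energy `≥ E_n` sits at frequencies `≥ λ_n` (Bernstein). [folklore] -/
def concentration (n : ℕ) : ℝ := S.Emin n * S.lam n ^ 2

/-- `E_n λ_n² = E₀ λ₀² (4η)ⁿ`. [folklore] -/
theorem concentration_eq (n : ℕ) : S.concentration n = S.E0 * S.lam0 ^ 2 * (4 * S.eta) ^ n := by
  unfold concentration Emin lam
  have h : ((2 : ℝ) ^ n) ^ 2 = 4 ^ n := by
    rw [← pow_mul, mul_comm, pow_mul]; norm_num
  rw [mul_pow, h, mul_pow]; ring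

/-- **`η > 1/4`: the concentration numbers diverge** — the cascade forces `‖u(t_n)‖_{Ḣ¹} → ∞`. [folklore] -/
theorem tendsto_concentration_atTop (hη : 1 / 4 < S.eta) : Tendsto S.concentration atTop atTop := by
  have h4 : (1 : ℝ) < 4 * S.eta := by linarith
  have hc : 0 < S.E0 * S.lam0 ^ 2 := mul_pos S.E0_pos (pow_pos S.lam0_pos 2)
  have h : Tendsto (fun n : ℕ => S.E0 * S.lam0 ^ 2 * (4 * S.eta) ^ n) atTop atTop :=
    (tendsto_pow_atTop_atTop_of_one_lt h4).const_mul_atTop hc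
  exact h.congr fun n => (S.concentration_eq n).symm

/-- **`η ≤ 1/4`: the concentration numbers stay bounded** — no norm growth is forced. [folklore] -/
theorem concentration_le (hη : S.eta ≤ 1 / 4) (n : ℕ) : S.concentration n ≤ S.E0 * S.lam0 ^ 2 := by
  rw [S.concentration_eq]
  have h1 : (4 * S.eta) ^ n ≤ 1 := pow_le_one₀ (by linarith [S.eta_pos]) (by linarith)
  exact mul_le_of_le_one_right (mul_pos S.E0_pos (pow_pos S.lam0_pos 2)).le h1

/-! ### The dimensional closure: `α_eff = 5/2 + ½ log₂ η` -/

/-- The **dimensional (eddy turn-over) transfer time** at level `n` for energy `E_n` at length scale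
`ℓ_n = λ_n^{-1}`: `c ℓ_n^{5/2} E_n^{-1/2} = c λ_n^{-5/2} E_n^{-1/2}` (velocity `∼ (E_n/ℓ_n³)^{1/2}`,
time `∼ ℓ_n / velocity`; Tao 2016, §6: lifespan `∼ 2^{-5n/2} e_n^{-1}` in amplitude units
`e_n² = E_n`). [cite: Tao2016AveragedNS, §6 (6.6)] -/
def dimensionalTime (c : ℝ) (n : ℕ) : ℝ := c * S.lam n ^ (-(5 / 2 : ℝ)) * S.Emin n ^ (-(1 / 2 : ℝ))

/-- The **effective transfer exponent** of the dimensional closure: `α_eff = 5/2 + ½ log₂ η`. [folklore] -/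
def alphaEff : ℝ := 5 / 2 + Real.logb 2 S.eta / 2

/-- `2^{-α_eff} = 2^{-5/2} η^{-1/2}`. [folklore] -/
theorem two_rpow_neg_alphaEff :
    (2 : ℝ) ^ (-S.alphaEff) = (2 : ℝ) ^ (-(5 / 2 : ℝ)) * S.eta ^ (-(1 / 2 : ℝ)) := by
  unfold alphaEff
  have h2 : (2 : ℝ) ^ Real.logb 2 S.eta = S.eta := Real.rpow_logb two_pos (by norm_num) S.eta_pos
  rw [show -(5 / 2 + Real.logb 2 S.eta / 2) = -(5 / 2 : ℝ) + Real.logb 2 S.eta * (-(1 / 2 : ℝ)) by ring,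
    Real.rpow_add two_pos, Real.rpow_mul zero_le_two, h2]

/-- **The dimensional time is a `C' λ_n^{-α_eff}` law**:
`c λ_n^{-5/2} E_n^{-1/2} = (c E₀^{-1/2} λ₀^{-5/2}) · (2^{-α_eff})ⁿ`. [folklore] -/
theorem dimensionalTime_eq_geometric (c : ℝ) (n : ℕ) :
    S.dimensionalTime c n =
      c * S.E0 ^ (-(1 / 2 : ℝ)) * S.lam0 ^ (-(5 / 2 : ℝ)) * ((2 : ℝ) ^ (-S.alphaEff)) ^ n := by
  unfold dimensionalTime Emin
  rw [S.lam_rpow, Real.mul_rpow S.E0_pos.le (pow_nonneg S.eta_pos.le n),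
    ← Real.rpow_pow_comm S.eta_pos.le, S.two_rpow_neg_alphaEff, mul_pow]
  ring

/-- The same law written against `λ_n`: `dimensionalTime c n = C' · λ_n^{-α_eff}` with
`C' = c E₀^{-1/2} λ₀^{α_eff - 5/2}`. [folklore] -/
theorem dimensionalTime_eq_rpow_lam (c : ℝ) (n : ℕ) :
    S.dimensionalTime c n =
      (c * S.E0 ^ (-(1 / 2 : ℝ)) * S.lam0 ^ (S.alphaEff - 5 / 2)) * S.lam n ^ (-S.alphaEff) := by
  rw [S.dimensionalTime_eq_geometric, S.lam_rpow]
  have h : S.lam0 ^ (S.alphaEff - 5 / 2) * S.lam0 ^ (-S.alphaEff) = S.lam0 ^ (-(5 / 2 : ℝ)) := by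
    rw [← Real.rpow_add S.lam0_pos]; ring_nf
  calc c * S.E0 ^ (-(1 / 2 : ℝ)) * S.lam0 ^ (-(5 / 2 : ℝ)) * ((2 : ℝ) ^ (-S.alphaEff)) ^ n
      = c * S.E0 ^ (-(1 / 2 : ℝ)) * (S.lam0 ^ (S.alphaEff - 5 / 2) * S.lam0 ^ (-S.alphaEff)) *
          ((2 : ℝ) ^ (-S.alphaEff)) ^ n := by rw [h]
    _ = _ := by ring

/-- **DICTIONARY, viscosity**: `α_eff ≥ 2 ⟺ η ≥ 1/2` — the dimensional cascade outruns viscosity iff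
at least half of the energy is handed down each level. [folklore] -/
theorem two_le_alphaEff_iff : 2 ≤ S.alphaEff ↔ 1 / 2 ≤ S.eta := by
  unfold alphaEff
  have h : (-1 : ℝ) ≤ Real.logb 2 S.eta ↔ (2 : ℝ) ^ (-1 : ℝ) ≤ S.eta :=
    Real.le_logb_iff_rpow_le one_lt_two S.eta_pos
  have h2 : (2 : ℝ) ^ (-1 : ℝ) = 1 / 2 := by
    rw [Real.rpow_neg zero_le_two, Real.rpow_one]; norm_num
  rw [h2] at h
  constructor
  · intro hle; exact h.1 (by linarith)
  · intro hη; have := h.2 hη; linarith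

/-- **DICTIONARY, strict form**: `α_eff > 2 ⟺ η > 1/2` (viscous numbers `→ 0`). [folklore] -/
theorem two_lt_alphaEff_iff : 2 < S.alphaEff ↔ 1 / 2 < S.eta := by
  unfold alphaEff
  have h : (-1 : ℝ) < Real.logb 2 S.eta ↔ (2 : ℝ) ^ (-1 : ℝ) < S.eta :=
    Real.lt_logb_iff_rpow_lt one_lt_two S.eta_pos
  have h2 : (2 : ℝ) ^ (-1 : ℝ) = 1 / 2 := by
    rw [Real.rpow_neg zero_le_two, Real.rpow_one]; norm_num
  rw [h2] at h
  constructor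
  · intro hle; exact h.1 (by linarith)
  · intro hη; have := h.2 hη; linarith

/-- **DICTIONARY, summability**: `α_eff > 0 ⟺ η > 2^{-5}` — below `η = 1/32` the dimensional transfer
times are not even summable (no finite-time cascade at all). [folklore] -/
theorem alphaEff_pos_iff : 0 < S.alphaEff ↔ (2 : ℝ) ^ (-5 : ℝ) < S.eta := by
  unfold alphaEff
  have h : (-5 : ℝ) < Real.logb 2 S.eta ↔ (2 : ℝ) ^ (-5 : ℝ) < S.eta :=
    Real.lt_logb_iff_rpow_lt one_lt_two S.eta_pos
  constructor
  · intro hle; exact h.1 (by linarith)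
  · intro hη; have := h.2 hη; linarith

/-- **DICTIONARY, `Ḣ¹` growth vs. viscosity**: the viscous threshold `η ≥ 1/2` is STRICTLY inside the
norm-growth regime `η > 1/4`; a cascade with `1/4 < η < 1/2` would blow up `Ḣ¹` for Euler-type
(inviscid) timing but is damped by viscosity under the dimensional closure. [folklore] -/
theorem quarter_lt_of_half_le (hη : 1 / 2 ≤ S.eta) : 1 / 4 < S.eta := by linarith

/-! ### Robustness load (how much slack each gadget has) -/

/-- The **robustness load** `L(η) = √(1-η) / (√(32 η) - 1)`: the ratio of the amplitude `√(1-η)` of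
the energy NOT handed down (junk left at level `n`, available to perturb level `n+1`) to the margin
`√(32η) - 1 = 2^{α_eff} - 1` by which the next level's clock is faster. Small `L` = comfortable;
Tao's machine runs at `η ≈ 0.986` per level, `L ≈ 0.026`. A heuristic figure of merit only — it is
DEFINED here so that the spec sheet and the assembly speak about the same quantity. [folklore] -/
def robustnessLoad : ℝ := Real.sqrt (1 - S.eta) / (Real.sqrt (32 * S.eta) - 1)

/-- `L(η) ≥ 0` once `η > 1/32` (the clock margin `√(32η) - 1` is positive). [folklore] -/
theorem robustnessLoad_nonneg (hη : 1 / 32 < S.eta) : 0 ≤ S.robustnessLoad := by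
  unfold robustnessLoad
  refine div_nonneg (Real.sqrt_nonneg _) ?_
  have h : 1 < Real.sqrt (32 * S.eta) := by
    rw [show (1 : ℝ) = Real.sqrt 1 by simp]
    exact Real.sqrt_lt_sqrt zero_le_one (by linarith)
  linarith

end CascadeSpecs

end Literature.Analysis.FluidPDE.FluidComputer

end
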